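import Literature.MathematicalPhysics.QuantumFieldTheory.Balaban1983to89.B11Eq71KernelConcrete
import Literature.MathematicalPhysics.QuantumFieldTheory.Balaban1983to89.B11Prop3Concrete

/-!
# `Balaban1983to89.B11Eq73KernelConcrete` — T. Bałaban, *The variational problem and background fields in renormalization group method
for lattice gauge theories*, Commun. Math. Phys. **102** (1985) 277–309 [Balaban1985Variational], (73) p. 289 FOR THE CONCRETE REMAINDER
`C_j(U₀, ·)` OF [4] ON THE `ℤᵈ` CARRIER, **WITH ITS EXPONENTIAL DECAY: «|𝔇(A′; c, b)| ≦ O(1)C₃ε₃(Lʲη)^{−d+1}e^{−(1/2)δ₀d(c₋,y)}, b ∈ Bʲ(y),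
y ∈ Λ_j»** for the functional derivative `𝔇 = (δ/δA′)D̃` of the concrete fixed point `D̃` of (49) — «The formula (70) and the inequalities (71),
(72) give finally the following inequality» with (70)/(68) = `B11Eq70Concrete.eq68_concrete`, (71) = `B11Eq71KernelConcrete`, (72) + the locality
of `(δC_j/δA)` = `B11Eq72Concrete`; the kernel decay of `H` ([5] Thm 3.12) is the hypothesis, Lemma 2.1 [3] enters BY NAME; this removes, for the
concrete `C_j`, the reading «(73) AT NORM LEVEL» (M6) of `B11Prop3Model`/`B11Prop3Concrete`

statement-level skeleton of published theorems with citation tags; proofs where landed; nothing here is a claim about the Yang–Mills mass gap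

PDF held: `paper:balaban1985-cmp102-variational-background` (journal page = PDF page + 276); p. 289 [PDF 13], render
`run/shared/lean/pub/pub-balaban/b2b-balaban-ref1/pages/1985-cmp102-variational-background/…-p013-x2.png` read as image by this seat
(2026-08-21); [3] = [Balaban1984PropagatorsII] Lemma 2.1; [4] = [Balaban1985Averaging] (141), (157); [5] = [Balaban1985BackgroundPropagators]
Thm 3.12.

CITATION HEADER / WHAT IS REPRODUCED.  Cell `lit-balaban`, Phase-2 proof seat p06 gen 7 = unit `lit-balaban-p06` (TAKING line HOME/STATUS.md
2026-08-21, gen 7; file 2 of the kernel-level lane after `B11Eq71KernelConcrete`); SKELETON rows **B11.Eq73** ((73); owner r08: `proved p245837`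
= `B11Eq73KernelDecay.ineq73`, (70)+(71)+(72) ⇒ (73) over ABSTRACT kernels on `B6.Geometry`, the three displays as hypotheses `h70`/`h71`/`h72`)
and **B11.Prop3** (clause «its functional derivative satisfies the bound (73)»; `B11Prop3Model`/`B11Prop3Concrete`: at NORM level).  THE PRINT
(p. 289): *«The formula (70) and the inequalities (71), (72) give finally the following inequality, |𝔇(A′; c, b)| ≦ O(1)C₃ε₃(Lʲη)^{−d+1}
e^{−(1/2)δ₀d(c₋,y)}, b ∈ Bʲ(y), y ∈ Λ_j. (73)»* and Proposition 3: *«The function D(A′) satisfies the bound (55) and its functional derivative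
satisfies the bound (73).»*

DICTIONARY (as `B11Eq71KernelConcrete`).  `𝔇(A′; c, b)` applied to `X ∈ 𝔸` ↦ `((δ/δA′)D̃(A′)(X·e_b))(c) = fderiv ℂ Dt A′ (Pi.single b X) c`
(the column `b` of the Fréchet derivative of the concrete `D̃ = Dt`, any map with the fixed-point characterization (49) + (55)-ball on
`‖A′‖ < ε`, `B12SecondOrder267Concrete.exists_Dt_concrete`); `(Lʲη)^{−d+1}C₃ε₃` ↦ `C₃(Lʲ)²·ε·L^{−jd}` (tree units: the one-bond weight `η^d` of
`δ/δA_b` is `L^{−jd}`, [4] (141), and `Lʲη·C₃·2ε₃` is (72)'s `C₃(Lʲ)²·2ε`); `d(c₋, y)`, `b ∈ Bʲ(y)` ↦ `l1(Lʲz − b₋)/Lʲ` (ℓ¹ distance from the block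
corner `c₋ = Lʲz` to the bond `b` itself, units of `Lʲη`; it differs from the distance to `y` by `≤ d`, inside `O(1)`); `θ`, `c₁ = d·c₀(δ₀,½)ᵈ`,
`q = θc₁` as in `B11Eq71KernelConcrete`; `O(1) := 2(1 − q)⁻¹e^{dδ₀}` (`= 4e^{dδ₀}` for `q ≤ ½`).

WHAT THIS FILE PROVES (theorems only; kernel, 0 sorry, standard axioms), in the regime of `B11Eq72Concrete`, `j ≤ k`, `0 < δ₀`:
* §1 **`ineq73_kernel_of_eq68`**: at `‖X₀‖ ≤ 2ε`, every solution `v ∈ 𝔸^T` of the column equation `(I + ℜ)v = 𝒞′(X·e_b)` ((68), column `b`)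
  satisfies `‖v(c)‖ ≤ (1 − q)⁻¹·e^{dδ₀}·C₃(Lʲ)²·2ε·L^{−jd}·‖X‖·e^{−½δ₀·l1(Lʲz − b₋)/Lʲ}` — source = the column (72) of size `C₃(Lʲ)²2εL^{−jd}`
  supported on the `c` with `b ⊂ Bʲ(c₋) ∪ Bʲ(c₊)` (`B11Eq72Concrete.ineq72_concrete_kerQdd`), spread by the profile contraction of
  `B11Eq71KernelConcrete` (Lemma 2.1 [3]).
* §2 **`ineq73_concrete`**: for the concrete `D̃` and every `‖A′‖ < ε` (regime «9C₂(Lʲ)²B₀ε < 1», `3ε < b`, (46) `‖HX‖ ≤ B₀‖X‖`, `hHker`, `q < 1`):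
  `‖((δ/δA′)D̃(A′))(X·e_b)(c)‖ ≤ (1 − q)⁻¹e^{dδ₀}·C₃(Lʲ)²·2ε·L^{−jd}·‖X‖·e^{−½δ₀·l1(Lʲz − b₋)/Lʲ}` — (73) VERBATIM in tree units with `O(1)`
  explicit; **`ineq73_concrete_two`** (`q ≤ ½`: `O(1) = 4e^{dδ₀}`, «≦ 2 … for ε₃ sufficiently small»).
* §3 (v1.1) **`ineq73_Dfix`** / `ineq73_Dfix_two`: the same two bounds for r08's SELECTOR `D(A′) = B11Prop3Model.Dfix (Cmap …) H (C₂(Lʲ)²)`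
  (the `D` of `B11Prop3Concrete.prop3_concrete` / `prop3Printed_concrete`, whose clause (v) reads (73) at norm level): its (49)+(55)-ball
  characterization is `B11Prop3Model.Dfix_ball`/`Dfix_fix` at `B11Eq44Concrete.quadAnalytic_Cmap`, so `ineq73_concrete` applies (`3ε ≤ b`).
NOT CLAIMED: the kernel bound of `H` ([5] Thm 3.12 — hypothesis `hHker`), the multi-scale version, the `𝔇₂` remark (p. 289: «the bound (73) with
ε₃² instead of ε₃» — operator form in `B11Rem289Concrete`).  NOT summit progress.
v1.1 (p06 gen 7): v1 (p305148) kept byte-identical; + 1 import (`B11Prop3Concrete`, r08 g10) + 1 `open` + §3.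
-/

noncomputable section

open scoped BigOperators Topology
open NormedSpace Finset Metric Filter

namespace Literature.MathematicalPhysics.QuantumFieldTheory.Balaban1983to89.B11Eq73KernelConcrete

open B7Prop1Explicit B7Prop1Local B7Prop2Explicit B7Prop3Flat B7Prop4Flat B7Eq92Concrete B7Prop3GeneralLinear
  B7Prop4GeneralLevels B7Prop5GeneralOperators B7Prop5GeneralInduction B7Prop5GeneralLevels B7Prop5General B7Ineq149Pairing
  B13Contraction113 B11Eq44Concrete B12SecondOrder267Concrete B11Eq70Concrete B11Eq72Concrete
open B7Prop5Flat (BondIn)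
open B11Eq71KernelConcrete
open B11Prop3Model (Dfix Dfix_ball Dfix_fix)

-- `Site` alone would resolve to the torus sites of `Setup.lean`; re-export the `ℤ^d` sites of `B7Prop1Explicit`.
export B7Prop1Explicit (Site)

variable {d : ℕ}

/-! ## §1–§2 (73) for the concrete `𝔇` -/

section Regime

variable {𝔸 : Type*} [NormedRing 𝔸] [NormedAlgebra ℂ 𝔸] [CompleteSpace 𝔸] [NormOneClass 𝔸]

variable (L : ℕ) (hL : 2 ≤ L) {G : Subgroup 𝔸ˣ} (hG : AvgClosed d L G) (k : ℕ)
  (U₀ : Site d → Fin d → 𝔸ˣ) (hU₀ : ∀ x κ, U₀ x κ ∈ G) {α₀ : ℝ} (hα : 0 < α₀)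
  (hα3 : C0 d * α₀ ≤ 1 / 3) (hα4 : 4 * α₀ ≤ c2' d L) (h52 : pdev U₀ < α₀ * (((L : ℝ) ^ k)⁻¹) ^ 2)
  {b : ℝ} (hb : 0 < b)
  (hsmall : Real.exp (4 * (800 * ((d : ℝ) + 1) ^ 2 * ((d : ℝ) + 4)) * α₀)
    * (1 + 8 * (131072 * ((d : ℝ) + 1) ^ 2) * ((L : ℝ) ^ k * b)) ≤ 2)
  (hc₃ : 4 * ((L : ℝ) ^ k * b) < c3 d L)
  (h145 : 8 * d * thetaGen d L α₀ * (L : ℝ)⁻¹ ^ 4 ≤ 1)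
  (h155 : (2 * (L : ℝ) - 1) * (L : ℝ)⁻¹ ^ 2 + 2 * d * thetaGen d L α₀ * (L : ℝ)⁻¹ ^ 3
    + 1 / 8 * (1 + 2 * d * thetaGen d L α₀ * (L : ℝ)⁻¹ ^ 2 + 2 * d * C3Gen d L * ((L : ℝ) ^ k * b)) * (L : ℝ)⁻¹ ^ 2 ≤ 1)
  (S T : Finset (Site d × Fin d)) (H : (T → 𝔸) →L[ℂ] (S → 𝔸)) {B₀ B₁ δ₀ ε : ℝ}

include hL hG hU₀ hα hα3 hα4 h52 hb hsmall hc₃ h145 h155 in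
/-- **(73) FROM (68)/(70), (71), (72), CONCRETE, WITH THE DECAY**: at `‖X₀‖ ≤ 2ε`, every solution `v ∈ 𝔸^T` of `(I + ℜ)v = 𝒞′(X·e_b)` (the
column `b` of (68); `v = 𝔇(X·e_b)` when `X₀ = A′ − HD̃(A′)`) satisfies, for every coarse bond `c = (z, κ)`,
`‖v(c)‖ ≤ (1 − q)⁻¹·e^{dδ₀}·C₃(Lʲ)²·2ε·L^{−jd}·e^{−½δ₀·l1(Lʲz − b₋)/Lʲ}·‖X‖` — the source `𝒞′(X·e_b)` is the column (72) of size
`C₃(Lʲ)²2εL^{−jd}` supported on the `c` with `b ⊂ Bʲ(c₋) ∪ Bʲ(c₊)` (within `2dLʲ` of `b`), and `(I + ℜ)⁻¹` spreads it with the decay (71).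
[cite: Balaban1985Variational, (73) p.289, (70)–(72) p.289] [cite: Balaban1985Averaging, (141) p.39, (157) p.42] -/
theorem ineq73_kernel_of_eq68 {j : ℕ} (hj : j ≤ k) (hε0 : 0 < ε) (hε : 2 * ε ≤ b) {X₀ : S → 𝔸} (hX₀ : ‖X₀‖ ≤ 2 * ε)
    (hδ₀ : 0 < δ₀) (hB₁ : 0 ≤ B₁)
    (hHker : ∀ (c'' : T) (Y : 𝔸) (s : S),
      ‖H (Pi.single c'' Y) s‖ ≤ B₁ * Real.exp (-(δ₀ * ((l1 (loK L j c''.1.1 - s.1.1) : ℝ) / (L : ℝ) ^ j))) * ‖Y‖)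
    (hq : (C3Gen d L * (((L : ℝ) ^ j) ^ 2 * (2 * ε)) * (2 * d) * B₁ * Real.exp (2 * d * δ₀)) * (d * B6.c0 δ₀ (1 / 2) ^ d) < 1)
    (bnd : S) (X : 𝔸) {v : T → 𝔸}
    (hv : v + fderiv ℂ (Cmap L U₀ S T j) X₀ (H v) = fderiv ℂ (Cmap L U₀ S T j) X₀ (Pi.single bnd X)) (c : T) :
    ‖v c‖ ≤ (1 - (C3Gen d L * (((L : ℝ) ^ j) ^ 2 * (2 * ε)) * (2 * d) * B₁ * Real.exp (2 * d * δ₀)) * (d * B6.c0 δ₀ (1 / 2) ^ d))⁻¹ *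
      (Real.exp (d * δ₀) * (C3Gen d L * ((L : ℝ) ^ j) ^ 2 * (2 * ε) * (((L : ℝ) ^ j) ^ d)⁻¹) * ‖X‖) *
        Real.exp (-(1 / 2 * δ₀ * ((l1 (loK L j c.1.1 - bnd.1.1) : ℝ) / (L : ℝ) ^ j))) := by
  classical
  have hL1 : 1 ≤ L := le_trans (by norm_num) hL
  have hC3 : 0 ≤ C3Gen d L := by unfold C3Gen C1ppGen; positivity
  have hLj : (0 : ℝ) < (L : ℝ) ^ j := by positivity
  set θ : ℝ := C3Gen d L * (((L : ℝ) ^ j) ^ 2 * (2 * ε)) * (2 * d) * B₁ * Real.exp (2 * d * δ₀) with hθ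
  have hθ0 : 0 ≤ θ := by positivity
  -- weight centred at the fine bond `b`: `wt(c) = e^{−½δ₀ l1(Lʲz − b₋)/Lʲ}`
  have key := decay_of_fixedPoint (ι := T) (F := 𝔸)
    (wt := fun c : T => Real.exp (-(1 / 2 * δ₀ * ((l1 (loK L j c.1.1 - bnd.1.1) : ℝ) / (L : ℝ) ^ j)))) (fun c => Real.exp_pos _)
    (v := v) (src := fderiv ℂ (Cmap L U₀ S T j) X₀ (Pi.single bnd X)) (Rv := fderiv ℂ (Cmap L U₀ S T j) X₀ (H v))
    (q := θ * (d * B6.c0 δ₀ (1 / 2) ^ d))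
    (A := Real.exp (d * δ₀) * (C3Gen d L * ((L : ℝ) ^ j) ^ 2 * (2 * ε) * (((L : ℝ) ^ j) ^ d)⁻¹) * ‖X‖) hq
    (fun c => by rw [← hv]; simp)
    (fun c => by
      -- the source: the column (72) with its locality weight `kerQdd`
      have h72 := ineq72_concrete_kerQdd L hL hG k U₀ hU₀ hα hα3 hα4 h52 hb hsmall hc₃ h145 h155 S T hj hε0 hε hX₀ bnd X c
      refine h72.trans ?_
      by_cases hin : BondIn (loK L j c.1.1) (bondHiK L j c.1.1 c.1.2) bnd.1.1 bnd.1.2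
      · rw [kerQdd_of_bondIn hin]
        have hbox := l1_loK_sub_le_of_bondIn hin
        have hwt : Real.exp (-(d * δ₀)) ≤ Real.exp (-(1 / 2 * δ₀ * ((l1 (loK L j c.1.1 - bnd.1.1) : ℝ) / (L : ℝ) ^ j))) := by
          refine Real.exp_le_exp.2 ?_
          have h2d : (l1 (loK L j c.1.1 - bnd.1.1) : ℝ) / (L : ℝ) ^ j ≤ 2 * d := by rw [div_le_iff₀ hLj]; exact hbox
          nlinarith
        have hone : Real.exp (d * δ₀) * Real.exp (-(d * δ₀)) = 1 := by
          rw [← Real.exp_add, add_neg_cancel, Real.exp_zero]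
        calc C3Gen d L * ((L : ℝ) ^ j) ^ 2 * (2 * ε) * (((L : ℝ) ^ j) ^ d)⁻¹ * ‖X‖
            = C3Gen d L * ((L : ℝ) ^ j) ^ 2 * (2 * ε) * (((L : ℝ) ^ j) ^ d)⁻¹ * ‖X‖ *
                (Real.exp (d * δ₀) * Real.exp (-(d * δ₀))) := by rw [hone, mul_one]
          _ = Real.exp (d * δ₀) * (C3Gen d L * ((L : ℝ) ^ j) ^ 2 * (2 * ε) * (((L : ℝ) ^ j) ^ d)⁻¹) * ‖X‖ *
                Real.exp (-(d * δ₀)) := by ring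
          _ ≤ Real.exp (d * δ₀) * (C3Gen d L * ((L : ℝ) ^ j) ^ 2 * (2 * ε) * (((L : ℝ) ^ j) ^ d)⁻¹) * ‖X‖ *
              Real.exp (-(1 / 2 * δ₀ * ((l1 (loK L j c.1.1 - bnd.1.1) : ℝ) / (L : ℝ) ^ j))) :=
              mul_le_mul_of_nonneg_left hwt (by positivity)
      · rw [kerQdd_of_not_bondIn hin, mul_zero, zero_mul]
        positivity)
    (fun M hM hvM c => by
      have h := profile_contraction (ι := T) (F := 𝔸) (fun c : T => c.1.1) hθ0
        (R := fun w => fderiv ℂ (Cmap L U₀ S T j) X₀ (H w))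
        (fun w i => ineq69_kernel L hL hG k U₀ hU₀ hα hα3 hα4 h52 hb hsmall hc₃ h145 h155 S T H hj hε0 hε hX₀ hδ₀.le hB₁ hHker w i)
        (fun i => rowSum_T T hδ₀ i.1.1)
        (wt := fun c : T => Real.exp (-(1 / 2 * δ₀ * ((l1 (loK L j c.1.1 - bnd.1.1) : ℝ) / (L : ℝ) ^ j))))
        (fun i => Real.exp_nonneg _)
        (fun i i'' => by
          rw [← Real.exp_add]
          refine Real.exp_le_exp.2 ?_
          have ht := scaled_triangle hL1 j i.1.1 i''.1.1 bnd.1.1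
          nlinarith)
        hM hvM c
      exact h)
    c
  refine key.trans (le_of_eq ?_)
  ring

variable {Dt : (S → 𝔸) → (T → 𝔸)}

include hL hG hU₀ hα hα3 hα4 h52 hb hsmall hc₃ h145 h155 in
/-- **(73) CONCRETE, WITH ITS EXPONENTIAL DECAY**: for the concrete `D̃` (any map with the fixed-point characterization (49) + (55)-ball on
`‖A′‖ < ε`; regime «9C₂B₀ε₃ < 1» with `C₂ ↦ C₂(Lʲ)²`, `3ε < b`), the kernel decay of `H` ([5] Thm 3.12, `hHker`) and `q = θc₁ < 1`: for every
`‖A′‖ < ε`, every fine bond `b ∈ S`, `X ∈ 𝔸` and every coarse bond `c = (z, κ) ∈ T`,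
`‖((δ/δA′)D̃(A′))(X·e_b)(c)‖ ≤ (1 − q)⁻¹·e^{dδ₀}·C₃(Lʲ)²·2ε·L^{−jd}·‖X‖·e^{−½δ₀·l1(Lʲz − b₋)/Lʲ}` — «|𝔇(A′; c, b)| ≦ O(1)C₃ε₃(Lʲη)^{−d+1}
e^{−(1/2)δ₀d(c₋,y)}» (73) with `O(1) = 2(1 − q)⁻¹e^{dδ₀}` ((68) = `B11Eq70Concrete.eq68_concrete` supplies the column equation, then
`ineq73_kernel_of_eq68`). [cite: Balaban1985Variational, (73) p.289, Prop. 3 p.289] -/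
theorem ineq73_concrete {j : ℕ} (hj : j ≤ k) (hB₀ : 0 ≤ B₀) (hH : ∀ X, ‖H X‖ ≤ B₀ * ‖X‖)
    (hq9 : 9 * ((8 * (131072 * ((d : ℝ) + 1) ^ 2) * Real.exp (4 * (800 * ((d : ℝ) + 1) ^ 2 * ((d : ℝ) + 4)) * α₀))
      * ((L : ℝ) ^ j) ^ 2) * B₀ * ε < 1) (hε3 : 3 * ε < b)
    (hDball : ∀ B : S → 𝔸, ‖B‖ < ε → Dt B ∈ closedBall (0 : T → 𝔸)
      (4 * ((8 * (131072 * ((d : ℝ) + 1) ^ 2) * Real.exp (4 * (800 * ((d : ℝ) + 1) ^ 2 * ((d : ℝ) + 4)) * α₀))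
        * ((L : ℝ) ^ j) ^ 2) * ε ^ 2))
    (hDfix : ∀ B : S → 𝔸, ‖B‖ < ε → Cmap L U₀ S T j (B - H (Dt B)) = Dt B)
    (hδ₀ : 0 < δ₀) (hB₁ : 0 ≤ B₁)
    (hHker : ∀ (c'' : T) (Y : 𝔸) (s : S),
      ‖H (Pi.single c'' Y) s‖ ≤ B₁ * Real.exp (-(δ₀ * ((l1 (loK L j c''.1.1 - s.1.1) : ℝ) / (L : ℝ) ^ j))) * ‖Y‖)
    (hq : (C3Gen d L * (((L : ℝ) ^ j) ^ 2 * (2 * ε)) * (2 * d) * B₁ * Real.exp (2 * d * δ₀)) * (d * B6.c0 δ₀ (1 / 2) ^ d) < 1)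
    {A' : S → 𝔸} (hA : ‖A'‖ < ε) (bnd : S) (X : 𝔸) (c : T) :
    ‖fderiv ℂ Dt A' (Pi.single bnd X) c‖ ≤
      (1 - (C3Gen d L * (((L : ℝ) ^ j) ^ 2 * (2 * ε)) * (2 * d) * B₁ * Real.exp (2 * d * δ₀)) * (d * B6.c0 δ₀ (1 / 2) ^ d))⁻¹ *
        (Real.exp (d * δ₀) * (C3Gen d L * ((L : ℝ) ^ j) ^ 2 * (2 * ε) * (((L : ℝ) ^ j) ^ d)⁻¹) * ‖X‖) *
          Real.exp (-(1 / 2 * δ₀ * ((l1 (loK L j c.1.1 - bnd.1.1) : ℝ) / (L : ℝ) ^ j))) := by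
  have hε0 : 0 < ε := (norm_nonneg _).trans_lt hA
  have hC2 : (0 : ℝ) ≤ (8 * (131072 * ((d : ℝ) + 1) ^ 2) * Real.exp (4 * (800 * ((d : ℝ) + 1) ^ 2 * ((d : ℝ) + 4)) * α₀))
      * ((L : ℝ) ^ j) ^ 2 := by positivity
  have hq4 : 4 * ((8 * (131072 * ((d : ℝ) + 1) ^ 2) * Real.exp (4 * (800 * ((d : ℝ) + 1) ^ 2 * ((d : ℝ) + 4)) * α₀))
      * ((L : ℝ) ^ j) ^ 2) * B₀ * ε ≤ 1 := by
    have hx : 0 ≤ (8 * (131072 * ((d : ℝ) + 1) ^ 2) * Real.exp (4 * (800 * ((d : ℝ) + 1) ^ 2 * ((d : ℝ) + 4)) * α₀))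
        * ((L : ℝ) ^ j) ^ 2 * B₀ * ε := mul_nonneg (mul_nonneg hC2 hB₀) hε0.le
    nlinarith
  have hX₀ := norm_X₀_le L S T H hB₀ hH hε0 hq4 hA (hDball A' hA)
  have h68 := eq68_concrete L hL hG k U₀ hU₀ hα hα3 hα4 h52 hb hsmall hc₃ S T H hj hB₀ hH hq9 hε3 hDball hDfix hA
  have hv : fderiv ℂ Dt A' (Pi.single bnd X) + fderiv ℂ (Cmap L U₀ S T j) (A' - H (Dt A')) (H (fderiv ℂ Dt A' (Pi.single bnd X))) =
      fderiv ℂ (Cmap L U₀ S T j) (A' - H (Dt A')) (Pi.single bnd X) := by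
    have h := congrArg (fun Φ : (S → 𝔸) →L[ℂ] (T → 𝔸) => Φ (Pi.single bnd X)) h68
    simpa using h
  exact ineq73_kernel_of_eq68 L hL hG k U₀ hU₀ hα hα3 hα4 h52 hb hsmall hc₃ h145 h155 S T H hj hε0 (by linarith) hX₀ hδ₀ hB₁ hHker hq
    bnd X hv c

include hL hG hU₀ hα hα3 hα4 h52 hb hsmall hc₃ h145 h155 in
/-- **(73) WITH `O(1) = 4e^{dδ₀}`** for `q ≤ ½` («for ε₃ sufficiently small», as the second member of (71)):
`‖((δ/δA′)D̃(A′))(X·e_b)(c)‖ ≤ 4e^{dδ₀}·C₃(Lʲ)²·ε·L^{−jd}·e^{−½δ₀·l1(Lʲz − b₋)/Lʲ}·‖X‖`. [cite: Balaban1985Variational, (73) p.289] -/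
theorem ineq73_concrete_two {j : ℕ} (hj : j ≤ k) (hB₀ : 0 ≤ B₀) (hH : ∀ X, ‖H X‖ ≤ B₀ * ‖X‖)
    (hq9 : 9 * ((8 * (131072 * ((d : ℝ) + 1) ^ 2) * Real.exp (4 * (800 * ((d : ℝ) + 1) ^ 2 * ((d : ℝ) + 4)) * α₀))
      * ((L : ℝ) ^ j) ^ 2) * B₀ * ε < 1) (hε3 : 3 * ε < b)
    (hDball : ∀ B : S → 𝔸, ‖B‖ < ε → Dt B ∈ closedBall (0 : T → 𝔸)
      (4 * ((8 * (131072 * ((d : ℝ) + 1) ^ 2) * Real.exp (4 * (800 * ((d : ℝ) + 1) ^ 2 * ((d : ℝ) + 4)) * α₀))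
        * ((L : ℝ) ^ j) ^ 2) * ε ^ 2))
    (hDfix : ∀ B : S → 𝔸, ‖B‖ < ε → Cmap L U₀ S T j (B - H (Dt B)) = Dt B)
    (hδ₀ : 0 < δ₀) (hB₁ : 0 ≤ B₁)
    (hHker : ∀ (c'' : T) (Y : 𝔸) (s : S),
      ‖H (Pi.single c'' Y) s‖ ≤ B₁ * Real.exp (-(δ₀ * ((l1 (loK L j c''.1.1 - s.1.1) : ℝ) / (L : ℝ) ^ j))) * ‖Y‖)
    (hq2 : (C3Gen d L * (((L : ℝ) ^ j) ^ 2 * (2 * ε)) * (2 * d) * B₁ * Real.exp (2 * d * δ₀)) * (d * B6.c0 δ₀ (1 / 2) ^ d) ≤ 1 / 2)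
    {A' : S → 𝔸} (hA : ‖A'‖ < ε) (bnd : S) (X : 𝔸) (c : T) :
    ‖fderiv ℂ Dt A' (Pi.single bnd X) c‖ ≤
      4 * Real.exp (d * δ₀) * (C3Gen d L * ((L : ℝ) ^ j) ^ 2 * ε * (((L : ℝ) ^ j) ^ d)⁻¹) *
        Real.exp (-(1 / 2 * δ₀ * ((l1 (loK L j c.1.1 - bnd.1.1) : ℝ) / (L : ℝ) ^ j))) * ‖X‖ := by
  have hε0 : 0 < ε := (norm_nonneg _).trans_lt hA
  have hC3 : 0 ≤ C3Gen d L := by unfold C3Gen C1ppGen; positivity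
  have h := ineq73_concrete L hL hG k U₀ hU₀ hα hα3 hα4 h52 hb hsmall hc₃ h145 h155 S T H hj hB₀ hH hq9 hε3 hDball hDfix hδ₀ hB₁ hHker
    (by linarith) hA bnd X c
  refine h.trans ?_
  have hinv : (1 - (C3Gen d L * (((L : ℝ) ^ j) ^ 2 * (2 * ε)) * (2 * d) * B₁ * Real.exp (2 * d * δ₀)) *
      (d * B6.c0 δ₀ (1 / 2) ^ d))⁻¹ ≤ 2 := by
    rw [inv_le_comm₀ (by linarith) (by norm_num : (0 : ℝ) < 2)]
    linarith
  have hrest : 0 ≤ (Real.exp (d * δ₀) * (C3Gen d L * ((L : ℝ) ^ j) ^ 2 * (2 * ε) * (((L : ℝ) ^ j) ^ d)⁻¹) * ‖X‖) *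
      Real.exp (-(1 / 2 * δ₀ * ((l1 (loK L j c.1.1 - bnd.1.1) : ℝ) / (L : ℝ) ^ j))) := by positivity
  calc (1 - (C3Gen d L * (((L : ℝ) ^ j) ^ 2 * (2 * ε)) * (2 * d) * B₁ * Real.exp (2 * d * δ₀)) * (d * B6.c0 δ₀ (1 / 2) ^ d))⁻¹ *
        (Real.exp (d * δ₀) * (C3Gen d L * ((L : ℝ) ^ j) ^ 2 * (2 * ε) * (((L : ℝ) ^ j) ^ d)⁻¹) * ‖X‖) *
          Real.exp (-(1 / 2 * δ₀ * ((l1 (loK L j c.1.1 - bnd.1.1) : ℝ) / (L : ℝ) ^ j)))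
      ≤ 2 * ((Real.exp (d * δ₀) * (C3Gen d L * ((L : ℝ) ^ j) ^ 2 * (2 * ε) * (((L : ℝ) ^ j) ^ d)⁻¹) * ‖X‖) *
          Real.exp (-(1 / 2 * δ₀ * ((l1 (loK L j c.1.1 - bnd.1.1) : ℝ) / (L : ℝ) ^ j)))) := by
        rw [mul_assoc]; exact mul_le_mul_of_nonneg_right hinv hrest
    _ = 4 * Real.exp (d * δ₀) * (C3Gen d L * ((L : ℝ) ^ j) ^ 2 * ε * (((L : ℝ) ^ j) ^ d)⁻¹) *
        Real.exp (-(1 / 2 * δ₀ * ((l1 (loK L j c.1.1 - bnd.1.1) : ℝ) / (L : ℝ) ^ j))) * ‖X‖ := by ring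

/-! ## §3 (v1.1) (73) with its decay for r08's selector `Dfix` -/

include hL hG hU₀ hα hα3 hα4 h52 hb hsmall hc₃ h145 h155 in
/-- **(73) WITH ITS EXPONENTIAL DECAY FOR THE SELECTOR `D(A′) = Dfix (C_j(U₀, ·)) H (C₂(Lʲ)²)`** of `B11Prop3Model`/`B11Prop3Concrete` (the
solution of (49) in the (55)-ball chosen by `Classical.epsilon`; = every `D̃` with that characterization, `B11Prop3Concrete.Dt_eq_Dfix`): in the
regime «9C₂(Lʲ)²B₀ε < 1», `3ε ≤ b`, with (46) `‖HX‖ ≤ B₀‖X‖`, the kernel decay `hHker` of `H` ([5] Thm 3.12) and `q = θc₁ < 1`, for every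
`‖A′‖ < ε`, fine bond `b`, `X ∈ 𝔸`, coarse bond `c = (z, κ)`:
`‖((δ/δA′)D(A′))(X·e_b)(c)‖ ≤ (1 − q)⁻¹e^{dδ₀}·C₃(Lʲ)²·2ε·L^{−jd}·‖X‖·e^{−½δ₀·l1(Lʲz − b₋)/Lʲ}` — clause (v) of Proposition 3 AT KERNEL LEVEL
for the concrete `C_j` (`ineq73_concrete` at `Dt := Dfix …`, its two hypotheses being `Dfix_ball`/`Dfix_fix` at `quadAnalytic_Cmap`).
[cite: Balaban1985Variational, (73) p.289, Prop. 3 p.289, (49) p.285, (55) p.286] -/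
theorem ineq73_Dfix {j : ℕ} (hj : j ≤ k) (hB₀ : 0 ≤ B₀) (hH : ∀ X, ‖H X‖ ≤ B₀ * ‖X‖)
    (hq9 : 9 * ((8 * (131072 * ((d : ℝ) + 1) ^ 2) * Real.exp (4 * (800 * ((d : ℝ) + 1) ^ 2 * ((d : ℝ) + 4)) * α₀))
      * ((L : ℝ) ^ j) ^ 2) * B₀ * ε < 1) (hε3 : 3 * ε < b)
    (hδ₀ : 0 < δ₀) (hB₁ : 0 ≤ B₁)
    (hHker : ∀ (c'' : T) (Y : 𝔸) (s : S),
      ‖H (Pi.single c'' Y) s‖ ≤ B₁ * Real.exp (-(δ₀ * ((l1 (loK L j c''.1.1 - s.1.1) : ℝ) / (L : ℝ) ^ j))) * ‖Y‖)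
    (hq : (C3Gen d L * (((L : ℝ) ^ j) ^ 2 * (2 * ε)) * (2 * d) * B₁ * Real.exp (2 * d * δ₀)) * (d * B6.c0 δ₀ (1 / 2) ^ d) < 1)
    {A' : S → 𝔸} (hA : ‖A'‖ < ε) (bnd : S) (X : 𝔸) (c : T) :
    ‖fderiv ℂ (Dfix (Cmap L U₀ S T j) (H : (T → 𝔸) →ₗ[ℂ] (S → 𝔸))
        ((8 * (131072 * ((d : ℝ) + 1) ^ 2) * Real.exp (4 * (800 * ((d : ℝ) + 1) ^ 2 * ((d : ℝ) + 4)) * α₀)) * ((L : ℝ) ^ j) ^ 2))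
        A' (Pi.single bnd X) c‖ ≤
      (1 - (C3Gen d L * (((L : ℝ) ^ j) ^ 2 * (2 * ε)) * (2 * d) * B₁ * Real.exp (2 * d * δ₀)) * (d * B6.c0 δ₀ (1 / 2) ^ d))⁻¹ *
        (Real.exp (d * δ₀) * (C3Gen d L * ((L : ℝ) ^ j) ^ 2 * (2 * ε) * (((L : ℝ) ^ j) ^ d)⁻¹) * ‖X‖) *
          Real.exp (-(1 / 2 * δ₀ * ((l1 (loK L j c.1.1 - bnd.1.1) : ℝ) / (L : ℝ) ^ j))) := by
  have hK : (0 : ℝ) ≤ (8 * (131072 * ((d : ℝ) + 1) ^ 2) * Real.exp (4 * (800 * ((d : ℝ) + 1) ^ 2 * ((d : ℝ) + 4)) * α₀))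
      * ((L : ℝ) ^ j) ^ 2 := by positivity
  have hQ := quadAnalytic_Cmap L hL hG k U₀ hU₀ hα hα3 hα4 h52 hb hsmall hc₃ S T hj
  have hH' : ∀ X, ‖(H : (T → 𝔸) →ₗ[ℂ] (S → 𝔸)) X‖ ≤ B₀ * ‖X‖ := fun X => by simpa using hH X
  exact ineq73_concrete L hL hG k U₀ hU₀ hα hα3 hα4 h52 hb hsmall hc₃ h145 h155 S T H hj hB₀ hH hq9 hε3
    (Dt := Dfix (Cmap L U₀ S T j) (H : (T → 𝔸) →ₗ[ℂ] (S → 𝔸))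
      ((8 * (131072 * ((d : ℝ) + 1) ^ 2) * Real.exp (4 * (800 * ((d : ℝ) + 1) ^ 2 * ((d : ℝ) + 4)) * α₀)) * ((L : ℝ) ^ j) ^ 2))
    (fun B hB => by simpa using Dfix_ball hQ hK hB₀ hH' hq9 hε3.le B hB)
    (fun B hB => by simpa using Dfix_fix hQ hK hB₀ hH' hq9 hε3.le B hB) hδ₀ hB₁ hHker hq hA bnd X c

include hL hG hU₀ hα hα3 hα4 h52 hb hsmall hc₃ h145 h155 in
/-- **(73) FOR `Dfix` WITH `O(1) = 4e^{dδ₀}`** (`q ≤ ½`, «for ε₃ sufficiently small»):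
`‖((δ/δA′)D(A′))(X·e_b)(c)‖ ≤ 4e^{dδ₀}·C₃(Lʲ)²·ε·L^{−jd}·e^{−½δ₀·l1(Lʲz − b₋)/Lʲ}·‖X‖`. [cite: Balaban1985Variational, (73) p.289, Prop. 3 p.289] -/
theorem ineq73_Dfix_two {j : ℕ} (hj : j ≤ k) (hB₀ : 0 ≤ B₀) (hH : ∀ X, ‖H X‖ ≤ B₀ * ‖X‖)
    (hq9 : 9 * ((8 * (131072 * ((d : ℝ) + 1) ^ 2) * Real.exp (4 * (800 * ((d : ℝ) + 1) ^ 2 * ((d : ℝ) + 4)) * α₀))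
      * ((L : ℝ) ^ j) ^ 2) * B₀ * ε < 1) (hε3 : 3 * ε < b)
    (hδ₀ : 0 < δ₀) (hB₁ : 0 ≤ B₁)
    (hHker : ∀ (c'' : T) (Y : 𝔸) (s : S),
      ‖H (Pi.single c'' Y) s‖ ≤ B₁ * Real.exp (-(δ₀ * ((l1 (loK L j c''.1.1 - s.1.1) : ℝ) / (L : ℝ) ^ j))) * ‖Y‖)
    (hq2 : (C3Gen d L * (((L : ℝ) ^ j) ^ 2 * (2 * ε)) * (2 * d) * B₁ * Real.exp (2 * d * δ₀)) * (d * B6.c0 δ₀ (1 / 2) ^ d) ≤ 1 / 2)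
    {A' : S → 𝔸} (hA : ‖A'‖ < ε) (bnd : S) (X : 𝔸) (c : T) :
    ‖fderiv ℂ (Dfix (Cmap L U₀ S T j) (H : (T → 𝔸) →ₗ[ℂ] (S → 𝔸))
        ((8 * (131072 * ((d : ℝ) + 1) ^ 2) * Real.exp (4 * (800 * ((d : ℝ) + 1) ^ 2 * ((d : ℝ) + 4)) * α₀)) * ((L : ℝ) ^ j) ^ 2))
        A' (Pi.single bnd X) c‖ ≤
      4 * Real.exp (d * δ₀) * (C3Gen d L * ((L : ℝ) ^ j) ^ 2 * ε * (((L : ℝ) ^ j) ^ d)⁻¹) *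
        Real.exp (-(1 / 2 * δ₀ * ((l1 (loK L j c.1.1 - bnd.1.1) : ℝ) / (L : ℝ) ^ j))) * ‖X‖ := by
  have hK : (0 : ℝ) ≤ (8 * (131072 * ((d : ℝ) + 1) ^ 2) * Real.exp (4 * (800 * ((d : ℝ) + 1) ^ 2 * ((d : ℝ) + 4)) * α₀))
      * ((L : ℝ) ^ j) ^ 2 := by positivity
  have hQ := quadAnalytic_Cmap L hL hG k U₀ hU₀ hα hα3 hα4 h52 hb hsmall hc₃ S T hj
  have hH' : ∀ X, ‖(H : (T → 𝔸) →ₗ[ℂ] (S → 𝔸)) X‖ ≤ B₀ * ‖X‖ := fun X => by simpa using hH X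
  exact ineq73_concrete_two L hL hG k U₀ hU₀ hα hα3 hα4 h52 hb hsmall hc₃ h145 h155 S T H hj hB₀ hH hq9 hε3
    (Dt := Dfix (Cmap L U₀ S T j) (H : (T → 𝔸) →ₗ[ℂ] (S → 𝔸))
      ((8 * (131072 * ((d : ℝ) + 1) ^ 2) * Real.exp (4 * (800 * ((d : ℝ) + 1) ^ 2 * ((d : ℝ) + 4)) * α₀)) * ((L : ℝ) ^ j) ^ 2))
    (fun B hB => by simpa using Dfix_ball hQ hK hB₀ hH' hq9 hε3.le B hB)
    (fun B hB => by simpa using Dfix_fix hQ hK hB₀ hH' hq9 hε3.le B hB) hδ₀ hB₁ hHker hq2 hA bnd X c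

end Regime

end Literature.MathematicalPhysics.QuantumFieldTheory.Balaban1983to89.B11Eq73KernelConcrete

end
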